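import Summits.CriticalPhenomena.PercolationContinuityZ3.Theorems.PercNearOneGluingNoHeavyLowerTailSahiQuantC3PrincipalFKG

/-!
# `NoHeavyLowerTail` (crux stmt-CriticalPhenomena-4575), Sahi programme: **THE QUANTITATIVE `C₃` ON SAHI'S WHOLE CLASS `𝒞`** —
# `2·E₃(f, g, h) ≥ E[fgh] − E[f]E[g]E[h]` for CUMULATIONS `f, g, h` under every FKG weight

Support file (Sahi cell, seat `prim-sahi-p1`, generation 48; `--supports stmt-CriticalPhenomena-4575`).  Pure proofs, NO definitions, no
`sorry`, standard axioms.  Part 3 of the quantitative-`C₃` files (`…SahiQuantC3Principal`: product weights on grids with an explicit slack;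
`…SahiQuantC3PrincipalFKG`: three principal up-sets under every FKG weight).

THE MATHEMATICS.  Sahi's Theorem 2 [Sahi 2008, Thm 2; FKG version Blinovsky 2014 — tree `sahiE_nonneg_of_isLatticeCumulation`] says
`E_n(f_1,…,f_n) ≥ 0` for `f_i` in the cumulation cone `𝒞` = nonnegative combinations of indicators of principal up-sets
(`IsLatticeCumulation`).  The quantitative `C₃` of `…SahiQuantC3PrincipalFKG`, `2E₃(χ_{↑a},χ_{↑b},χ_{↑c}) ≥ μ(↑a∩↑b∩↑c) − μ(↑a)μ(↑b)μ(↑c)`,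
has BOTH sides trilinear in the three slots (`E₃` by Sahi's multilinearity, `E[fgh] − E f·E g·E h` obviously), so it extends verbatim to the
cone (`quantDefect_slot0/1/2`: the defect `2E₃(f,g,h) − (E[fgh] − E f E g E h)` is linear in each slot over finite nonnegative combinations):

  **THEOREM (`two_mul_sahiE_three_cumulation_ge`).**  For an FKG probability weight `μ` on a finite distributive lattice and `f, g, h ∈ 𝒞`:
  `E_μ[fgh] − E_μ[f]·E_μ[g]·E_μ[h] ≤ 2·E₃^{μ}(f, g, h)`.

The constant `2` (i.e. `κ = ½`) is sharp already for indicators (`two_mul_latticeE3_self_sub`).  This answers prim-sahi-p2 gen 33's question (memo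
FROM-prim-sahi-p2-gen33-TWO-LEVEL-ORACLE §8) on Sahi's class `𝒞` in the form 'positivity of `E₃` with an explicit margin `½·(M₁₂₃ − M₁M₂M₃)`'.  It does NOT
extend to arbitrary increasing `f, g, h` (p2 gen 4: unions of principal up-sets admit no `κ > 0`). [this work]
-/

namespace Summit.CriticalPhenomena.PercolationContinuityZ3.Theorems.SahiQuantC3

open Finset Function Literature.Probability.LatticeModels Literature.Combinatorics.Sahi2008
open scoped BigOperators

noncomputable section

variable {α : Type*} [Fintype α]

/-! ### Linearity of the defect in each slot -/

section Linear

/-- `E_μ` of a finite nonnegative combination. [folklore] -/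
theorem ex_sum_smul (μ : α → ℝ) {ι : Type*} (s : Finset ι) (c : ι → ℝ) (φ : ι → α → ℝ) :
    ex μ (∑ a ∈ s, c a • φ a) = ∑ a ∈ s, c a * ex μ (φ a) := by
  classical
  induction s using Finset.induction_on with
  | empty => simp [ex_def]
  | insert a s ha ih => rw [Finset.sum_insert ha, Finset.sum_insert ha, ex_add, ex_smul, ih]

omit [Fintype α] in
/-- Pointwise: `(Σ c•φ)·g·h = Σ c•(φ·g·h)`. [folklore] -/
theorem sum_smul_mul_mul {ι : Type*} (s : Finset ι) (c : ι → ℝ) (φ : ι → α → ℝ) (g h : α → ℝ) :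
    (∑ a ∈ s, c a • φ a) * g * h = ∑ a ∈ s, c a • (φ a * g * h) := by
  funext x
  simp only [Pi.mul_apply, Finset.sum_apply, Pi.smul_apply, smul_eq_mul, Finset.sum_mul]
  exact Finset.sum_congr rfl fun a _ => by ring

omit [Fintype α] in
/-- Pointwise: `f·(Σ c•φ)·h = Σ c•(f·φ·h)`. [folklore] -/
theorem mul_sum_smul_mul {ι : Type*} (s : Finset ι) (c : ι → ℝ) (φ : ι → α → ℝ) (f h : α → ℝ) :
    f * (∑ a ∈ s, c a • φ a) * h = ∑ a ∈ s, c a • (f * φ a * h) := by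
  funext x
  simp only [Pi.mul_apply, Finset.sum_apply, Pi.smul_apply, smul_eq_mul, Finset.mul_sum, Finset.sum_mul]
  exact Finset.sum_congr rfl fun a _ => by ring

omit [Fintype α] in
/-- Pointwise: `f·g·(Σ c•φ) = Σ c•(f·g·φ)`. [folklore] -/
theorem mul_mul_sum_smul {ι : Type*} (s : Finset ι) (c : ι → ℝ) (φ : ι → α → ℝ) (f g : α → ℝ) :
    f * g * (∑ a ∈ s, c a • φ a) = ∑ a ∈ s, c a • (f * g * φ a) := by
  funext x
  simp only [Pi.mul_apply, Finset.sum_apply, Pi.smul_apply, smul_eq_mul, Finset.mul_sum]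
  exact Finset.sum_congr rfl fun a _ => by ring

/-- **The defect `2E₃(f,g,h) − (E[fgh] − E f E g E h)` is linear in slot 0.** [this work] -/
theorem quantDefect_slot0 (μ : α → ℝ) {ι : Type*} (s : Finset ι) (c : ι → ℝ) (φ : ι → α → ℝ) (g h : α → ℝ) :
    2 * sahiE μ 3 ![∑ a ∈ s, c a • φ a, g, h] - (ex μ ((∑ a ∈ s, c a • φ a) * g * h) - ex μ (∑ a ∈ s, c a • φ a) * ex μ g * ex μ h) =
      ∑ a ∈ s, c a * (2 * sahiE μ 3 ![φ a, g, h] - (ex μ (φ a * g * h) - ex μ (φ a) * ex μ g * ex μ h)) := by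
  have hupd : ∀ ψ : α → ℝ, (![ψ, g, h] : Fin 3 → α → ℝ) = update ![0, g, h] 0 ψ := by
    intro ψ; funext i; fin_cases i <;> simp
  rw [hupd, sahiE_update_sum_smul, sum_smul_mul_mul, ex_sum_smul, ex_sum_smul]
  simp only [← hupd]
  rw [Finset.mul_sum, Finset.sum_mul, Finset.sum_mul, ← Finset.sum_sub_distrib, ← Finset.sum_sub_distrib]
  exact Finset.sum_congr rfl fun a _ => by ring

/-- The defect is linear in slot 1. [this work] -/
theorem quantDefect_slot1 (μ : α → ℝ) {ι : Type*} (s : Finset ι) (c : ι → ℝ) (φ : ι → α → ℝ) (f h : α → ℝ) :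
    2 * sahiE μ 3 ![f, ∑ a ∈ s, c a • φ a, h] - (ex μ (f * (∑ a ∈ s, c a • φ a) * h) - ex μ f * ex μ (∑ a ∈ s, c a • φ a) * ex μ h) =
      ∑ a ∈ s, c a * (2 * sahiE μ 3 ![f, φ a, h] - (ex μ (f * φ a * h) - ex μ f * ex μ (φ a) * ex μ h)) := by
  have hupd : ∀ ψ : α → ℝ, (![f, ψ, h] : Fin 3 → α → ℝ) = update ![f, 0, h] 1 ψ := by
    intro ψ; funext i; fin_cases i <;> simp
  rw [hupd, sahiE_update_sum_smul, mul_sum_smul_mul, ex_sum_smul, ex_sum_smul]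
  simp only [← hupd]
  rw [Finset.mul_sum, Finset.mul_sum, Finset.sum_mul, ← Finset.sum_sub_distrib, ← Finset.sum_sub_distrib]
  exact Finset.sum_congr rfl fun a _ => by ring

/-- The defect is linear in slot 2. [this work] -/
theorem quantDefect_slot2 (μ : α → ℝ) {ι : Type*} (s : Finset ι) (c : ι → ℝ) (φ : ι → α → ℝ) (f g : α → ℝ) :
    2 * sahiE μ 3 ![f, g, ∑ a ∈ s, c a • φ a] - (ex μ (f * g * (∑ a ∈ s, c a • φ a)) - ex μ f * ex μ g * ex μ (∑ a ∈ s, c a • φ a)) =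
      ∑ a ∈ s, c a * (2 * sahiE μ 3 ![f, g, φ a] - (ex μ (f * g * φ a) - ex μ f * ex μ g * ex μ (φ a))) := by
  have hupd : ∀ ψ : α → ℝ, (![f, g, ψ] : Fin 3 → α → ℝ) = update ![f, g, 0] 2 ψ := by
    intro ψ; funext i; fin_cases i <;> simp
  rw [hupd, sahiE_update_sum_smul, mul_mul_sum_smul, ex_sum_smul, ex_sum_smul]
  simp only [← hupd]
  rw [Finset.mul_sum, Finset.mul_sum, ← Finset.sum_sub_distrib, ← Finset.sum_sub_distrib]
  exact Finset.sum_congr rfl fun a _ => by ring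

end Linear

/-! ### The quantitative `C₃` on the cumulation cone -/

section Cumulation

variable [DistribLattice α] [DecidableEq α] [DecidableLE α]

/-- The indicator case in `ex`-form: for an FKG probability weight and principal up-sets,
`E[χ_Aχ_Bχ_C] − E[χ_A]E[χ_B]E[χ_C] ≤ 2E₃(χ_A,χ_B,χ_C)`. [this work] -/
theorem two_mul_sahiE_three_principal_ge' {μ : α → ℝ} (hμ : IsFKGMeasure μ) (a b c : α) :
    ex μ (setInd (principalUp a) * setInd (principalUp b) * setInd (principalUp c))
        - ex μ (setInd (principalUp a)) * ex μ (setInd (principalUp b)) * ex μ (setInd (principalUp c)) ≤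
      2 * sahiE μ 3 ![setInd (principalUp a), setInd (principalUp b), setInd (principalUp c)] := by
  have h := two_mul_sahiE_three_principal_ge hμ a b c
  simp only [setInd_mul, ex_setInd]
  exact h

/-- **THE QUANTITATIVE `C₃` ON SAHI'S CLASS `𝒞`.**  For an FKG probability weight `μ` on a finite distributive lattice and cumulations
`f, g, h` (nonnegative combinations of indicators of principal up-sets): `E_μ[fgh] − E_μ[f]E_μ[g]E_μ[h] ≤ 2·E₃^{μ}(f,g,h)`.
Both sides are trilinear, so this is the principal-indicator theorem `two_mul_sahiE_three_principal_ge` summed with nonnegative weights.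
[this work] -/
theorem two_mul_sahiE_three_cumulation_ge {μ : α → ℝ} (hμ : IsFKGMeasure μ) {f g h : α → ℝ} (hf : IsLatticeCumulation f)
    (hg : IsLatticeCumulation g) (hh : IsLatticeCumulation h) :
    ex μ (f * g * h) - ex μ f * ex μ g * ex μ h ≤ 2 * sahiE μ 3 ![f, g, h] := by
  obtain ⟨cf, hcf, hfe⟩ := hf
  obtain ⟨cg, hcg, hge⟩ := hg
  obtain ⟨ch, hch, hhe⟩ := hh
  rw [eq_sum_smul_setInd_of_isLatticeCumulation hfe, eq_sum_smul_setInd_of_isLatticeCumulation hge,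
    eq_sum_smul_setInd_of_isLatticeCumulation hhe]
  rw [← sub_nonneg, quantDefect_slot0]
  refine Finset.sum_nonneg fun a _ => mul_nonneg (hcf a) ?_
  rw [quantDefect_slot1]
  refine Finset.sum_nonneg fun b _ => mul_nonneg (hcg b) ?_
  rw [quantDefect_slot2]
  refine Finset.sum_nonneg fun c _ => mul_nonneg (hch c) ?_
  exact sub_nonneg.2 (two_mul_sahiE_three_principal_ge' hμ a b c)

end Cumulation

end

end Summit.CriticalPhenomena.PercolationContinuityZ3.Theorems.SahiQuantC3
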